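/-
Copyright (c) 2026 the pub-hodgecm-mathlib formalisation cell (harness21).  Prover seat hodgecm-mathlib-R90-CS-p03 (g4), Track B ∕ R90-TF, h413 = `stmt-HodgeConjecture-24833`,
R90-TF section S8 «ContSpec-n½» (S8 dealer R90-CS-plan (g4) S8-R290 (5) «(w2) PB-3a-loc `hloc`»; census R90 bus «standard Satake computation, S–M»): the local letter `hloc` of ★ p865246
`sum_mul_pseudoEisenstein_rightTranslate_eq_of_localLetter` PAID HYPOTHESIS-FIRST from the STRUCTURE of the unramified double coset (Borel representatives, `K_v`-permutation, local
Iwasawa factorisation) — place-free and measure-free algebra.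
-/
import Summits.HodgeConjecture.HodgeConjecture.Theorems.R90S8PseudoEisensteinHeckeShiftU3   -- ★ p865246 (F0P2-p11 (g4)): `sum_mul_pseudoEisenstein_rightTranslate_eq_of_localLetter` (its `hloc` binder :203 is this file's conclusion); brings ★ `borelHeight_borel_mul`, ★ `IsChiSectionPair`
import HarnessLib

/-!
# S8 (E) :276, E1-PLANCHEREL brick PB-3a-loc — `R90S8PseudoEisensteinLocalHeckeLetterU3`: the LOCAL SATAKE LETTER `hloc` «`Σ_i c·f(H(x k_i))·ψ(x k_i) = f♮(H x)·ψ x`» from the structure of the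
# unramified double coset

Track B ∕ R90-TF, crux h413 = `stmt-HodgeConjecture-24833`, route of record `HCCMUnconditional`; cell `hodgecm-mathlib`, R90-TF section S8 «ContSpec-n½», socket (E)
`sock_S8_res_exhaustion_le_closure` (B :276), E1-PLANCHEREL BODY, brick PB-3a (★ p865246 `R90S8PseudoEisensteinHeckeShiftU3`, whose heads are stated MODULO the local letter `hloc`).
THEOREMS ONLY (no `def`, no `instance`, no `notation`, no named-fact hypothesis, no `sorry`; default heartbeats); lane `--supports stmt-HodgeConjecture-24833 --as helper` (count-neutral).
CLOSES NO SOCKET.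

THE MATHEMATICS ([Cartier1979] §IV (4.2)–(4.4); [MoeglinWaldspurger1995] I.2.6, II.1.2–II.1.3; [Garrett2018] §2.2, §2.8).  The unramified Hecke operator at `v ∤ 𝔫` on right-`K_v`-invariant
functions is `F ↦ Σ_i c·F(· k_i)` over the left cosets `K_v t_v K_v = ⊔_i k_i K_v` (equal volumes `c`).  THREE STRUCTURAL FACTS compute it on the profile section `F = (f ∘ H)·ψ`
(`H` the Borel height, `ψ` a `(χ₁, χ₂)`-pair-section, ★ `IsChiSectionPair`): (R) the representatives may be taken in `B(𝔸)` (Iwasawa at `v`) — so `H(k_i g) = q_i·H(g)`, `ψ(k_i g) = χ(k_i)·ψ(g)`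
(★ `borelHeight_borel_mul`, ★ `IsChiSectionPair.borel_mul`; `q_i := ‖(k_i)_{NN}‖⁻¹`, `χ(k_i) := χ₁((k_i)₀₀)·χ₂((k_i)₁₁)`); (P) `K_v` PERMUTES the cosets: `κ·k_i = k_{σ(κ) i}·κ′` with `κ′ ∈ K_v`;
(I) LOCAL IWASAWA IN GLOBAL FORM: every `x` is `b·y·κ` with `b ∈ B(𝔸)`, `κ ∈ K_v` and `y` COMMUTING with every `k_i` (`y` = the off-`v` part of `x` times nothing at `v`; components at distinct
places commute).  With `H` and `ψ` right-`K_v`-invariant (`K_v ≤ K_max`, `ψ` unramified at `v`): `x k_i = b y κ k_i = b·k_{σi}·y·κ′`, so `f(H(x k_i))·ψ(x k_i) = f(q_b q_{σ i} H(y))·χ(b)χ(k_{σ i})ψ(y)`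
and `H x = q_b H(y)`, `ψ x = χ(b) ψ(y)`; re-indexing the finite sum along the permutation `σ` gives **`Σ_i c·f(H(x k_i))·ψ(x k_i) = (Σ_i c·χ(k_i)·f(q_i·H x))·ψ x`** — the letter `hloc`
of ★ p865246 with the Satake-shaped profile `f♮ r = Σ_i (c·χ(k_i))·f(q_i·r)` (★ §1 of p865246: `f♮ ∈ C_c((0,∞))` again, `mellin f♮ s = (Σ_i c χ(k_i) q_i^{−s})·mellin f s`).  The three
structural facts are VISIBLE BINDERS (they are the definition data of the Hecke operator in the (L1) currency of K2E1-p16 (g4) ∕ F0P2-p10 (g4), not analysis), so this file is pure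
finite algebra: no place decomposition, no measure.
* §1 `apply_borel_mul_of_commute` (bookkeeping: `ψ (b * k * y * κ) = χ(b)·χ(k)·ψ y`, `H (b * k * y * κ) = q_b·q_k·H y`).
* §2 HEAD **`hloc_of_borelRepresentatives`** — ★ p865246's `hloc` BYTES (at `s := Finset.univ`, constant weight `c`, `fd := f♮`) from (R)(P)(I) + right-`K_v`-invariance.
* §3 `sum_mul_pseudoEisenstein_rightTranslate_eq_of_borelRepresentatives` — ★ p865246's head with `hloc` DISCHARGED by §2 (the Hecke shift of the pseudo-Eisenstein generators
  `Σ_i c·θ_{f,ψ}(g k_i) = θ_{f♮,ψ}(g)` from the structure letters alone).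
HONEST LABEL: HC_CM is proved only modulo the 7 printed citations (2 remaining named inputs: hLiu418 = `stmt-HodgeConjecture-24832`, h413 = `stmt-HodgeConjecture-24833`) until
rung 0 closes; REL ≠ ★ ≠ BUILT; PB-3a after this file = ★ MODULO the STRUCTURE letters (R)(P)(I) of the double coset at `v` (S each, the Hecke operator's definition data in the (L1)
port currency) and the `L²` port; no named fact, no socket; count-neutral.

## References
* [Cartier1979] P. Cartier, *Representations of p-adic groups: a survey*, Corvallis PSPM 33.1 (1979), §IV (4.2)–(4.4).
* [MoeglinWaldspurger1995] C. Mœglin, J.-L. Waldspurger, *Spectral Decomposition and Eisenstein Series* (1995), I.2.6, II.1.2–II.1.3, II.1.10.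
* [Garrett2018] P. Garrett, *Modern Analysis of Automorphic Forms by Example* (2018), §2.2, §2.8.
-/

set_option autoImplicit false
set_option linter.dupNamespace false  -- the mandated namespace repeats the summit's segment (`HodgeConjecture.HodgeConjecture`)

noncomputable section

open MeasureTheory Measure Set Filter Topology NumberField
open Literature.NumberTheory Literature.NumberTheory.Automorphic Literature.NumberTheory.Automorphic.UnitaryGroup AdelicGroupData
open Literature.NumberTheory.Automorphic.Arthur2013.Leaves.TECR
open Literature.NumberTheory.GaloisRepresentations (HeckeCharacter)
open Summit.HodgeConjecture.HodgeConjecture.Cruxes.H413.K2E1BorelEisensteinU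
open Summit.HodgeConjecture.HodgeConjecture.Cruxes.H413.K2E1CharacterEisensteinU2Defs (firstEntryUnit)
open Summit.HodgeConjecture.HodgeConjecture.Cruxes.H413.K2E1CharacterEisensteinU3PairDefs
open Summit.HodgeConjecture.HodgeConjecture.Cruxes.H413.R90S8PseudoEisensteinHeckeShiftU3 (sum_mul_pseudoEisenstein_rightTranslate_eq_of_localLetter)
open scoped ENNReal NNReal

namespace Summit.HodgeConjecture.HodgeConjecture.Cruxes.H413.R90S8PseudoEisensteinLocalHeckeLetterU3

variable (L : Type) [Field L] [NumberField L] [IsCMField L]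

/-! ## §1 Bookkeeping: the section and the height along `b · k · y · κ` -/

/-- **`ψ (b·k·y·κ) = χ(b)·χ(k)·ψ(y)` and `ψ (b·y·κ) = χ(b)·ψ(y)`** for a pair-section `ψ` right-invariant under `K_v ∋ κ` and `b, k ∈ B(𝔸)` (★ `IsChiSectionPair.borel_mul` twice).
[cite: MoeglinWaldspurger1995, I.2.17, II.1.2] -/
theorem section_borel_mul_mul_mul {χ₁ : HeckeCharacter L} {χ₂ : ↥(TorusDict.torus (IsCMField.complexConj L)) →ₜ* ℂˣ}
    {ψ : (quasiSplit (↥(maximalRealSubfield L)) L (IsCMField.complexConj L) 3).Adelic → ℂ} (hψ : IsChiSectionPair χ₁ χ₂ ψ)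
    (Kv : Subgroup (quasiSplit (↥(maximalRealSubfield L)) L (IsCMField.complexConj L) 3).Adelic) (hKψ : ∀ κ ∈ Kv, ∀ g, ψ (g * κ) = ψ g)
    {b k y κ : (quasiSplit (↥(maximalRealSubfield L)) L (IsCMField.complexConj L) 3).Adelic}
    (hb : b ∈ borelAdelic (↥(maximalRealSubfield L)) L (IsCMField.complexConj L) 3) (hk : k ∈ borelAdelic (↥(maximalRealSubfield L)) L (IsCMField.complexConj L) 3) (hκ : κ ∈ Kv) :
    ψ (b * k * y * κ) = (((χ₁ (firstEntryUnit hb) : ℂˣ) : ℂ) * ((χ₂ (middleEntryUnitary hb) : ℂˣ) : ℂ)) *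
      ((((χ₁ (firstEntryUnit hk) : ℂˣ) : ℂ) * ((χ₂ (middleEntryUnitary hk) : ℂˣ) : ℂ)) * ψ y) := by
  rw [hKψ κ hκ, mul_assoc b k y, hψ.borel_mul hb, hψ.borel_mul hk]

/-- **`H (b·k·y·κ) = q_b·(q_k·H(y))`** for `b, k ∈ B(𝔸)` and `κ ∈ K_v` with `H` right-`K_v`-invariant (★ `borelHeight_borel_mul` twice). [cite: Garrett2018, §2.2] -/
theorem borelHeight_borel_mul_mul_mul (Kv : Subgroup (quasiSplit (↥(maximalRealSubfield L)) L (IsCMField.complexConj L) 3).Adelic)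
    (hKH : ∀ κ ∈ Kv, ∀ g : (quasiSplit (↥(maximalRealSubfield L)) L (IsCMField.complexConj L) 3).Adelic, borelHeight (g * κ) = borelHeight g)
    {b k y κ : (quasiSplit (↥(maximalRealSubfield L)) L (IsCMField.complexConj L) 3).Adelic}
    (hb : b ∈ borelAdelic (↥(maximalRealSubfield L)) L (IsCMField.complexConj L) 3) (hk : k ∈ borelAdelic (↥(maximalRealSubfield L)) L (IsCMField.complexConj L) 3) (hκ : κ ∈ Kv) :
    borelHeight (b * k * y * κ) = (IdeleClassGroup.ideleNorm L (lastEntryUnit hb))⁻¹ * ((IdeleClassGroup.ideleNorm L (lastEntryUnit hk))⁻¹ * borelHeight y) := by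
  rw [hKH κ hκ, mul_assoc b k y, borelHeight_borel_mul hb, borelHeight_borel_mul hk]

/-! ## §2 HEAD: the local Satake letter from the structure of the double coset -/

/-- **HEAD — THE LOCAL SATAKE LETTER `hloc` FROM THE STRUCTURE OF THE UNRAMIFIED DOUBLE COSET.**  Data: a `(χ₁, χ₂)`-pair-section `ψ` (★ `IsChiSectionPair`); a subgroup `K_v ≤ G(𝔸)` under
which `ψ` and the Borel height `H` are right-invariant (`hKψ`, `hKH` — `ψ` unramified at `v`, `K_v ≤ K_max`); representatives `k : ι → G(𝔸)` of the left cosets of `K_v t_v K_v`, ALL IN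
`B(𝔸)` (`hkB`, fact (R): Iwasawa at `v`); the PERMUTATION letter (P) `hperm : ∀ κ ∈ K_v, ∃ σ : Equiv.Perm ι, ∀ i, ∃ κ′ ∈ K_v, κ·k_i = k_{σ i}·κ′`; the local IWASAWA factorisation in global
form (I) `hIw : ∀ x, ∃ b ∈ B(𝔸), ∃ y, ∃ κ ∈ K_v, x = b·y·κ ∧ ∀ i, y·k_i = k_i·y`; an equal weight `c`.  CONCLUSION = ★ p865246's `hloc` at `s := univ` with the Satake-shaped profile
`f♮ r := Σ_i (c·χ₁((k_i)₀₀)·χ₂((k_i)₁₁))·f(‖(k_i)_{NN}‖⁻¹·r)`: `∀ x, Σ_i c·(f(H(x k_i))·ψ(x k_i)) = f♮(H x)·ψ x`.  Pure finite algebra (`Finset.sum_equiv` along `σ`).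
[cite: Cartier1979, §IV (4.2)–(4.4)] [cite: MoeglinWaldspurger1995, II.1.2–II.1.3] [cite: Garrett2018, §2.8] -/
theorem hloc_of_borelRepresentatives (f : ℝ → ℂ) {χ₁ : HeckeCharacter L} {χ₂ : ↥(TorusDict.torus (IsCMField.complexConj L)) →ₜ* ℂˣ}
    {ψ : (quasiSplit (↥(maximalRealSubfield L)) L (IsCMField.complexConj L) 3).Adelic → ℂ} (hψ : IsChiSectionPair χ₁ χ₂ ψ)
    (Kv : Subgroup (quasiSplit (↥(maximalRealSubfield L)) L (IsCMField.complexConj L) 3).Adelic)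
    (hKH : ∀ κ ∈ Kv, ∀ g : (quasiSplit (↥(maximalRealSubfield L)) L (IsCMField.complexConj L) 3).Adelic, borelHeight (g * κ) = borelHeight g)
    (hKψ : ∀ κ ∈ Kv, ∀ g, ψ (g * κ) = ψ g)
    {ι : Type*} [Fintype ι] (c : ℂ) (k : ι → (quasiSplit (↥(maximalRealSubfield L)) L (IsCMField.complexConj L) 3).Adelic)
    (hkB : ∀ i, k i ∈ borelAdelic (↥(maximalRealSubfield L)) L (IsCMField.complexConj L) 3)
    (hperm : ∀ κ ∈ Kv, ∃ σ : Equiv.Perm ι, ∀ i, ∃ κ' ∈ Kv, κ * k i = k (σ i) * κ')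
    (hIw : ∀ x : (quasiSplit (↥(maximalRealSubfield L)) L (IsCMField.complexConj L) 3).Adelic,
      ∃ b, ∃ _ : b ∈ borelAdelic (↥(maximalRealSubfield L)) L (IsCMField.complexConj L) 3, ∃ y κ, κ ∈ Kv ∧ x = b * y * κ ∧ ∀ i, y * k i = k i * y) :
    ∀ x : (quasiSplit (↥(maximalRealSubfield L)) L (IsCMField.complexConj L) 3).Adelic,
      ∑ i ∈ Finset.univ, c * (f (borelHeight (x * k i) : ℝ) * ψ (x * k i)) =
        (fun r : ℝ => ∑ i ∈ Finset.univ, (c * (((χ₁ (firstEntryUnit (hkB i)) : ℂˣ) : ℂ) * ((χ₂ (middleEntryUnitary (hkB i)) : ℂˣ) : ℂ))) *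
          f ((((IdeleClassGroup.ideleNorm L (lastEntryUnit (hkB i)))⁻¹ : ℝ≥0) : ℝ) * r)) (borelHeight x : ℝ) * ψ x := by
  intro x
  obtain ⟨b, hb, y, κ, hκ, rfl, hcomm⟩ := hIw x
  obtain ⟨σ, hσ⟩ := hperm κ hκ
  -- the terms along `x k_i = b · k_{σ i} · y · κ′_i`
  have hterm : ∀ i, c * (f (borelHeight (b * y * κ * k i) : ℝ) * ψ (b * y * κ * k i)) =
      (c * (((χ₁ (firstEntryUnit (hkB (σ i))) : ℂˣ) : ℂ) * ((χ₂ (middleEntryUnitary (hkB (σ i))) : ℂˣ) : ℂ))) *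
        f ((((IdeleClassGroup.ideleNorm L (lastEntryUnit (hkB (σ i))))⁻¹ : ℝ≥0) : ℝ) * (borelHeight (b * y * κ) : ℝ)) * ψ (b * y * κ) := by
    intro i
    obtain ⟨κ', hκ', hκk⟩ := hσ i
    have hx : b * y * κ * k i = b * k (σ i) * y * κ' := by
      rw [mul_assoc (b * y) κ (k i), hκk, ← mul_assoc (b * y), mul_assoc b y (k (σ i)), hcomm (σ i), ← mul_assoc b]
    rw [hx, section_borel_mul_mul_mul L hψ Kv hKψ hb (hkB (σ i)) hκ', borelHeight_borel_mul_mul_mul L Kv hKH hb (hkB (σ i)) hκ',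
      show ψ (b * y * κ) = (((χ₁ (firstEntryUnit hb) : ℂˣ) : ℂ) * ((χ₂ (middleEntryUnitary hb) : ℂˣ) : ℂ)) * ψ y by rw [hKψ κ hκ, hψ.borel_mul hb],
      show borelHeight (b * y * κ) = (IdeleClassGroup.ideleNorm L (lastEntryUnit hb))⁻¹ * borelHeight y by rw [hKH κ hκ, borelHeight_borel_mul hb]]
    push_cast
    ring_nf
  simp_rw [hterm]
  rw [← Finset.sum_mul]
  congr 1
  -- re-index along the permutation `σ`
  exact Fintype.sum_equiv σ _ _ fun i => rfl

/-! ## §3 ★ p865246's head with `hloc` discharged -/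

/-- **THE HECKE SHIFT OF THE PSEUDO-EISENSTEIN GENERATORS FROM THE STRUCTURE LETTERS**: `Σ_i c·θ_{f,ψ}(g·k_i) = θ_{f♮,ψ}(g)` for every `g`, with `f♮ r = Σ_i c·χ(k_i)·f(q_i·r)` — ★
`sum_mul_pseudoEisenstein_rightTranslate_eq_of_localLetter` (p865246) ∘ §2.  (`f ∈ C_c((0,∞))`, `ψ` bounded, as there.) [cite: MoeglinWaldspurger1995, II.1.2, II.1.10] [cite: Garrett2018, §2.8] -/
theorem sum_mul_pseudoEisenstein_rightTranslate_eq_of_borelRepresentatives {f : ℝ → ℂ} (hfc : Continuous f) (hfs : HasCompactSupport f) (hf0 : tsupport f ⊆ Ioi 0)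
    {χ₁ : HeckeCharacter L} {χ₂ : ↥(TorusDict.torus (IsCMField.complexConj L)) →ₜ* ℂˣ}
    {ψ : (quasiSplit (↥(maximalRealSubfield L)) L (IsCMField.complexConj L) 3).Adelic → ℂ} (hψ : IsChiSectionPair χ₁ χ₂ ψ) {M : ℝ} (hψM : ∀ x, ‖ψ x‖ ≤ M)
    (Kv : Subgroup (quasiSplit (↥(maximalRealSubfield L)) L (IsCMField.complexConj L) 3).Adelic)
    (hKH : ∀ κ ∈ Kv, ∀ g : (quasiSplit (↥(maximalRealSubfield L)) L (IsCMField.complexConj L) 3).Adelic, borelHeight (g * κ) = borelHeight g)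
    (hKψ : ∀ κ ∈ Kv, ∀ g, ψ (g * κ) = ψ g)
    {ι : Type*} [Fintype ι] (c : ℂ) (k : ι → (quasiSplit (↥(maximalRealSubfield L)) L (IsCMField.complexConj L) 3).Adelic)
    (hkB : ∀ i, k i ∈ borelAdelic (↥(maximalRealSubfield L)) L (IsCMField.complexConj L) 3)
    (hperm : ∀ κ ∈ Kv, ∃ σ : Equiv.Perm ι, ∀ i, ∃ κ' ∈ Kv, κ * k i = k (σ i) * κ')
    (hIw : ∀ x : (quasiSplit (↥(maximalRealSubfield L)) L (IsCMField.complexConj L) 3).Adelic,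
      ∃ b, ∃ _ : b ∈ borelAdelic (↥(maximalRealSubfield L)) L (IsCMField.complexConj L) 3, ∃ y κ, κ ∈ Kv ∧ x = b * y * κ ∧ ∀ i, y * k i = k i * y) :
    ∀ g : (quasiSplit (↥(maximalRealSubfield L)) L (IsCMField.complexConj L) 3).Adelic,
      ∑ i ∈ Finset.univ, c * eisensteinSeriesU (fun y : (quasiSplit (↥(maximalRealSubfield L)) L (IsCMField.complexConj L) 3).Adelic => f (borelHeight y : ℝ) * ψ y) (g * k i) =
        eisensteinSeriesU (fun y : (quasiSplit (↥(maximalRealSubfield L)) L (IsCMField.complexConj L) 3).Adelic =>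
          (fun r : ℝ => ∑ i ∈ Finset.univ, (c * (((χ₁ (firstEntryUnit (hkB i)) : ℂˣ) : ℂ) * ((χ₂ (middleEntryUnitary (hkB i)) : ℂˣ) : ℂ))) *
            f ((((IdeleClassGroup.ideleNorm L (lastEntryUnit (hkB i)))⁻¹ : ℝ≥0) : ℝ) * r)) (borelHeight y : ℝ) * ψ y) g :=
  sum_mul_pseudoEisenstein_rightTranslate_eq_of_localLetter L hfc hfs hf0 hψM Finset.univ (fun _ => c) k
    (fun r : ℝ => ∑ i ∈ Finset.univ, (c * (((χ₁ (firstEntryUnit (hkB i)) : ℂˣ) : ℂ) * ((χ₂ (middleEntryUnitary (hkB i)) : ℂˣ) : ℂ))) *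
      f ((((IdeleClassGroup.ideleNorm L (lastEntryUnit (hkB i)))⁻¹ : ℝ≥0) : ℝ) * r))
    (hloc_of_borelRepresentatives L f hψ Kv hKH hKψ c k hkB hperm hIw)

end Summit.HodgeConjecture.HodgeConjecture.Cruxes.H413.R90S8PseudoEisensteinLocalHeckeLetterU3

end
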